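import Literature.MathematicalPhysics.QuantumFieldTheory.Balaban1983to89.B13ResidualSlotProbe9
import Summits.QuantumFields.YangMills.Theorems.BalabanUVNodesN10AtRecord

/-!
# DAG node N10 · [B13] — THE STUB OF RECORD `YMDAG.UVSplit.S_N10 Rec := AtRecord Rec Dag.B13_main` READ AT NODE 00's RECORD PREDICATES OF RECORD:
# at `Rec :=` ₅C ∕ ₇C ∕ ₈C it is FALSE (unconditionally), at ₉C it is FALSE as soon as ₉C is inhabited; hence the K2 cluster statement `FlowBounds Rec` is
# FALSE there too, and the `slots` hypothesis of the seat's landed closers `N10AtRecord.s_N10_rec₅C ∕ ₇C ∕ ₈C` is UNSATISFIABLE — the Summits-side face, in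
# cluster K2's own vocabulary, of `Balaban1983to89.B13ResidualSlotProbe` ∕ `…Probe9` (Literature, same seat); plus THE GENERIC REGRESSION TEST: every
# inhabited record predicate closed under swaps of the residual carrier families `X, Y, Z` makes the stub FALSE

Cell `pub-ymgap`, YM-PLAN Track A (HUMAN RULING D-0062), seat `pub-ymgap-dag-p2` = n10-a (generation 6; KNIT-BY-NAME seat of node N10 = [Balaban1988RG2Cluster]
Lemmas 1–3 pp. 9, 11, 20; statement of record `Dag.B13_main (DagBinding.leavesP w P)` = «b9 → b10 → b11 → b12 → b13»).  Pattern: n07-a's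
`BalabanUVNodesN07RecordCensus` (the same census for `S_N07`).  The route module `BalabanUVNodesClustersCore` (dagwriter's UVSplit cut R420 (C), filed by this
seat as courier) types every paper-node stub as `AtRecord Rec Dag.<Bk>_main` over a record-predicate PARAMETER `Rec : RecordPred N`; cluster K2 «FlowBounds»
takes `h10 : S_N10 Rec` (`FlowBounds_of`, third argument).  This file answers, for N10, «at which `Rec` is the stub a TRUE statement?» against the tree's record
predicates of record: `Node00.IsRecordOfRecord₅C` (chair R434 (Q2) = (C)), its refinements `IsRecordOfRecord₇C` ∕ `₈C` (def-R ∕ def-B objects), and def-T's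
Stage-9 record `IsRecordOfRecord₉C` (`Node00/Record9`, 2026-08-26; carriers `X, Y, Z` still residual there by its own located remark TS-9⁺ ∕ R9-a).
THEOREMS ONLY (0 `def`, 0 `sorry`, standard axioms); `--supports stmt-QuantumFields-19183`.

WHAT IS PROVED.
* **`not_s_N10_record₅C ∕ ₇C ∕ ₈C`** — the stub at `Rec := IsRecordOfRecord₅C ∕ ₇C ∕ ₈C` is FALSE: on the family `L = 13, m = 1` there is a record at every run
  of which the in-edge leaves `b9 b10 b11 b12` HOLD and `b13` FAILS (`B13ResidualSlotProbe.not_forall_record₅C∕₇C∕₈C_b13_main'`).  **`not_s_N10_record₉C`** —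
  the same at ₉C relative to one ₉C record on some family (`B13ResidualSlotProbe9.not_forall_record₉C_b13_main`; inhabitation of ₉C is the plan's item K0).
* **`not_flowBounds_record₅C ∕ ₇C ∕ ₈C`**, **`not_flowBounds_record₉C`** — hence the CLOSED cluster statement K2 `FlowBounds Rec` is false at those `Rec`
  (its third conjunct is `Dag.B13_main`): a ∀-form node-cluster CHILD of the route (the split layer below the rev-1 items, plan [YMPLAN-G62-READ-B13SLOT]:
  the four rev-1 items K0 `Record9Inhabited` ∕ K1 ∕ K2 `EndpointGivenBR9` ∕ K3 read no B9–B13 leaf and are NOT touched) instantiated at a record predicate that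
  leaves the B13 group `(res.X P).S13 ∕ c13` residual is BORN REFUTABLE — so no such child is filed by `--split` until the stage it quantifies over pins (or
  displays) the leaf slots it reads; the carrier-pinning successor record — Stage 4(X.B13) — is the earliest sound instantiation for N10.
* **`not_slots₅C`** — the hypothesis `slots` of `N10AtRecord.s_N10_rec₅C ∕ _rec₇C ∕ _rec₈C ∕ _of_refines₅C` (the displayed slot (B13₅) over all admissible
  Stage-5 parameters of every family) is UNSATISFIABLE (`B13ResidualSlotProbe.not_slot₅C'`): those landed closers are correct AND CERTIFIED VACUOUS at
  ₅C ∕ ₇C ∕ ₈C — they are NOT progress on N10, only the socket a pin fills — dag-ref-B READ #249 D2 settled in the kernel.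
* THE REPAIR SHAPE is NOT re-typed here (it is landed and `Rec`-generic): `N10AtRecord.s_N10_of_leaf_b13` (the stub from the world's own `b13` leaf at every
  record) fed, per record and run, by `B13NodeKnitRecord5C.b13_main_at_stage5ParamsC_twoTorus` (the leaf from a torus pin `(res.X P).S13 = Wt.toStepData`,
  `c13 = c` + the torus triple `B13NodeTorusTermwise.b13Leaf_twoTorus_primitives` ∕ `B13NodeTorusKernel216.b13Leaf_twoTorus_kernel216`).  LOCATED CAVEAT: any
  closer whose pin hypothesis is quantified over ALL admissible parameters of an UNPINNED stage (e.g. «∀ admissible θ, (θ.res.X P).S13 = Wt θ P …» at ₅C–₉C)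
  is as vacuous as the slot — the pin must be a clause OF THE RECORD PREDICATE (the carrier-pinning successor), not a hypothesis over its free parameters.
* **`not_s_N10_of_swapClosed`** — THE GENERIC REGRESSION TEST for later record stages: EVERY record predicate `Rec` that is inhabited on some family and closed
  under swapping the residual carrier families `X, Y, Z` of the Stage-5 parameters its worlds are bound over (as ₅C ∕ ₇C ∕ ₈C ∕ ₉C are) makes `S_N10 Rec` FALSE
  (θ-level witness `exists_swap_inEdges_not_b13`); a successor record escapes it exactly by PINNING (at least) `(res.X P).S13 ∕ c13`.
* (v2) **`not_torusPin₅C`** ∕ **`not_torusPinHyp₅C`** — the LOCATED CAVEAT above as a theorem: a torus-pin hypothesis «∀ admissible θ, ∀ P,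
  `(θ.res.X P).S13 = (Wt θ P).toStepData`» over the unpinned Stage-5 parameters is UNSATISFIABLE (a domain-free residual step is the record of no torus step),
  so the hypothesis `hS` of `N10AtRecord.s_N10_of_refines₅C_twoTorus` ∕ `B13NodeKnitRecord5C.b13_main_forall_isRecordOfRecord₅C_twoTorus` is too.
* (v2) **`not_s_N10_of_s13SwapClosed`** — THE TEST OF THE B13 PIN ITSELF for NODE 00's CUMULATIVE carrier pins (`₉CB10`, `₉CB10Y`, …): a record predicate with
  ONE record and run at which `b9 b10 b11 b12` hold, closed under swapping ONLY `(res.X P).S13`, makes `S_N10` FALSE — whatever else is pinned; the stage that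
  pins the B13 group is the first that can pass (instance `not_s_N10_record₅C''`).

HONEST FRAMING: count-neutral bookkeeping over the route's stub and NODE 00's predicates; N10 NOT discharged; nothing of Bałaban's asserted or denied at his
objects — the refuting records are DEGENERATE probes of the typing over free residual fields; one finite four-torus programme at fixed `ε`; nothing continuum ∕
ℝ⁴ ∕ OS ∕ mass-gap ∕ Clay.
-/

noncomputable section

namespace Summit.QuantumFields.YangMills.Theorems.BalabanUVNodesN10RecordCensus

open Literature.MathematicalPhysics.QuantumFieldTheory.Balaban1983to89
open Literature.MathematicalPhysics.QuantumFieldTheory.Balaban1983to89.T4Continuum (T4Family FiniteEpsData)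
open Literature.MathematicalPhysics.QuantumFieldTheory.Balaban1983to89.DagBinding
  (WorldP leavesP B9LeafX B11Leaf PrintedCarriersR PrintedCarriers9X PrintedCarriers11)
open Literature.MathematicalPhysics.QuantumFieldTheory.Balaban1983to89.Node00
  (Stage5Params IsRecordOfRecord₅C IsRecordOfRecord₇C IsRecordOfRecord₈C IsRecordOfRecord₉C upOfRecord₅C)
open YMDAG.UVSplit (RecordPred AtRecord S_N10 FlowBounds)

variable (N : ℕ) [NeZero N]

/-! ## §1 The stub is FALSE at the record predicates of record -/

/-- **`S_N10` at `Rec := IsRecordOfRecord₅C` is FALSE**: on the four-torus family `L = 13, m = 1` there is a ₅C record at every run of which the in-edge leaves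
`b9`, `b10`, `b11`, `b12` hold and `b13` fails, so «b9 → b10 → b11 → b12 → b13» fails (`B13ResidualSlotProbe.not_forall_record₅C_b13_main'`).  Cluster K2's
hypothesis `h10` is unsatisfiable at this `Rec`. [cite: Balaban1988RG2Cluster, Lemmas 1–3 pp.9, 11, 20 (bookkeeping: the universal form over the unpinned Stage-5 record is refutable)] -/
theorem not_s_N10_record₅C : ¬ S_N10 (fun F D w => IsRecordOfRecord₅C F N D w) := by
  intro h
  let F13 : T4Family := ⟨13, ⟨⟨6, rfl⟩, by norm_num⟩, by norm_num, 1, le_rfl⟩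
  exact B13ResidualSlotProbe.not_forall_record₅C_b13_main' F13 N (h F13)

/-- **`S_N10` at `Rec := IsRecordOfRecord₇C` is FALSE** (`B13ResidualSlotProbe.not_forall_record₇C_b13_main'`, through the ₈C witness).
[cite: Balaban1988RG2Cluster, Lemmas 1–3 pp.9, 11, 20 (bookkeeping: the universal form over the unpinned Stage-7 record is refutable)] -/
theorem not_s_N10_record₇C : ¬ S_N10 (fun F D w => IsRecordOfRecord₇C F N D w) := by
  intro h
  let F13 : T4Family := ⟨13, ⟨⟨6, rfl⟩, by norm_num⟩, by norm_num, 1, le_rfl⟩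
  exact B13ResidualSlotProbe.not_forall_record₇C_b13_main' F13 N (h F13)

/-- **`S_N10` at `Rec := IsRecordOfRecord₈C` is FALSE** (₈C is inhabited on every family by `Node00.Record8Inhabited`; `B13ResidualSlotProbe.not_forall_record₈C_b13_main'`).
[cite: Balaban1988RG2Cluster, Lemmas 1–3 pp.9, 11, 20 (bookkeeping: the universal form over the unpinned Stage-8 record is refutable)] -/
theorem not_s_N10_record₈C : ¬ S_N10 (fun F D w => IsRecordOfRecord₈C F N D w) := by
  intro h
  let F13 : T4Family := ⟨13, ⟨⟨6, rfl⟩, by norm_num⟩, by norm_num, 1, le_rfl⟩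
  exact B13ResidualSlotProbe.not_forall_record₈C_b13_main' F13 N (h F13)

/-- **`S_N10` at `Rec := IsRecordOfRecord₉C` is FALSE as soon as one ₉C record exists on some family** (def-T's Stage-9 record keeps the carriers residual;
inhabitation of ₉C = the plan's analytic item K0 «Record9Inhabited»): `B13ResidualSlotProbe9.not_forall_record₉C_b13_main`.
[cite: Balaban1988RG2Cluster, Lemmas 1–3 pp.9, 11, 20 (bookkeeping: the universal form over the unpinned Stage-9 record is refutable)] -/
theorem not_s_N10_record₉C (hex : ∃ (F : T4Family) (D : FiniteEpsData F (Node00.SU N)) (w : WorldP), IsRecordOfRecord₉C F N D w) :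
    ¬ S_N10 (fun F D w => IsRecordOfRecord₉C F N D w) := by
  intro h
  obtain ⟨F, D, w, hw⟩ := hex
  exact B13ResidualSlotProbe9.not_forall_record₉C_b13_main hw (h F)

/-! ## §2 Hence the CLOSED K2 cluster statement is false at those record predicates -/

/-- **K2 «FlowBounds» at `Rec := IsRecordOfRecord₅C` is FALSE** (its N10 conjunct is). [cite: Balaban1988RG2Cluster, Lemmas 1–3 pp.9, 11, 20 (bookkeeping over the route's cluster statement)] -/
theorem not_flowBounds_record₅C : ¬ FlowBounds (fun F D w => IsRecordOfRecord₅C F N D w) :=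
  fun h => not_s_N10_record₅C N fun F D w hR P => (h F D w hR P).2.2.1

/-- **K2 «FlowBounds» at `Rec := IsRecordOfRecord₇C` is FALSE.** [cite: Balaban1988RG2Cluster, Lemmas 1–3 pp.9, 11, 20 (bookkeeping over the route's cluster statement)] -/
theorem not_flowBounds_record₇C : ¬ FlowBounds (fun F D w => IsRecordOfRecord₇C F N D w) :=
  fun h => not_s_N10_record₇C N fun F D w hR P => (h F D w hR P).2.2.1

/-- **K2 «FlowBounds» at `Rec := IsRecordOfRecord₈C` is FALSE.** [cite: Balaban1988RG2Cluster, Lemmas 1–3 pp.9, 11, 20 (bookkeeping over the route's cluster statement)] -/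
theorem not_flowBounds_record₈C : ¬ FlowBounds (fun F D w => IsRecordOfRecord₈C F N D w) :=
  fun h => not_s_N10_record₈C N fun F D w hR P => (h F D w hR P).2.2.1

/-- **K2 «FlowBounds» at `Rec := IsRecordOfRecord₉C` is FALSE as soon as ₉C is inhabited on some family.**
[cite: Balaban1988RG2Cluster, Lemmas 1–3 pp.9, 11, 20 (bookkeeping over the route's cluster statement)] -/
theorem not_flowBounds_record₉C (hex : ∃ (F : T4Family) (D : FiniteEpsData F (Node00.SU N)) (w : WorldP), IsRecordOfRecord₉C F N D w) :
    ¬ FlowBounds (fun F D w => IsRecordOfRecord₉C F N D w) :=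
  fun h => not_s_N10_record₉C N hex fun F D w hR P => (h F D w hR P).2.2.1

/-! ## §3 The `slots` hypothesis of the landed closers is unsatisfiable -/

/-- **The hypothesis `slots` of `N10AtRecord.s_N10_rec₅C ∕ _rec₇C ∕ _rec₈C ∕ _of_refines₅C` is UNSATISFIABLE**: the displayed slot (B13₅) «for every family, every
admissible Stage-5 parameter and every run, the in-edge leaves at the residual carriers imply the B13 triple of the residual group» fails on the family
`L = 13, m = 1` (`B13ResidualSlotProbe.not_slot₅C'`) — the landed closers are correct and vacuous until a pin of `(res.X P).S13 ∕ c13` (Stage 4(X.B13));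
dag-ref-B READ #249 D2. [cite: Balaban1988RG2Cluster, Lemmas 1–3 pp.9, 11, 20; p.1 (in-edges) (bookkeeping: satisfiability of the displayed slot)] -/
theorem not_slots₅C :
    ¬ ∀ (F : T4Family) (θ : Stage5Params F N), θ.Admissible → ∀ P : B12.RunParams,
        B9LeafX (θ.res.Y P) →
          (B10.Thm1PrintedCompact (θ.res.X P).runs10 ∧ B10.Thm2Printed (θ.res.X P).runs10) →
            B11Leaf (θ.res.Z P) → B12Sec2to5.Lemma4Printed (θ.res.X P).F12 (θ.res.X P).c12 →
              B13.Lemma1Printed (θ.res.X P).S13 (θ.res.X P).c13 ∧ B13.Lemma2Printed (θ.res.X P).S13 (θ.res.X P).c13 ∧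
                B13.Lemma3Printed (θ.res.X P).S13 (θ.res.X P).c13 := by
  intro h
  let F13 : T4Family := ⟨13, ⟨⟨6, rfl⟩, by norm_num⟩, by norm_num, 1, le_rfl⟩
  exact B13ResidualSlotProbe.not_slot₅C' F13 N (h F13)

/-! ## §4 The generic regression test: an inhabited record predicate closed under carrier swaps refutes the stub -/

/-- **θ-LEVEL WITNESS** (module 1's, stated once over bare Stage-5 parameters): for every `θ` there are carrier families `X', Y', Z'` such that at every world bound
to the C-binding of record over `θ` with its residual `X, Y, Z` so swapped, and every run, the in-edge leaves `b9 b10 b11 b12` HOLD and `b13` FAILS.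
[cite: Balaban1988RG2Cluster, Lemmas 1–3 pp.9, 11, 20; p.1 (in-edges) (bookkeeping: the witness over the Stage-5 parameters)] -/
theorem exists_swap_inEdges_not_b13 {F : T4Family} (θ : Stage5Params F N) :
    ∃ (X' : B12.RunParams → PrintedCarriersR) (Y' : B12.RunParams → PrintedCarriers9X) (Z' : B12.RunParams → PrintedCarriers11),
      ∀ (w : WorldP) (P : B12.RunParams),
        w.up P = upOfRecord₅C F N ({ θ with res := { θ.res with X := X', Y := Y', Z := Z' } } : Stage5Params F N) P →
          (leavesP w P).b9 ∧ (leavesP w P).b10 ∧ (leavesP w P).b11 ∧ (leavesP w P).b12 ∧ ¬ (leavesP w P).b13 := by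
  obtain ⟨Y₁, -, -, -, hY₁⟩ := B9LeafKnitNonVacuity.exists_b9LeafX_of_vanishing_operators
  obtain ⟨Z₁, -, hZ₁⟩ := B11LeafUnpinnedRecord.exists_b11Leaf
  let junk : B12.RunParams → B13.StepData := fun P =>
    Classical.choose (B13ResidualLeafProbe.exists_stepData_not_lemma1 ((θ.res.X P).c13))
  have hjunk : ∀ P, ¬ B13.Lemma1Printed (junk P) ((θ.res.X P).c13) := fun P =>
    Classical.choose_spec (B13ResidualLeafProbe.exists_stepData_not_lemma1 ((θ.res.X P).c13))
  let X' : B12.RunParams → PrintedCarriersR := fun P =>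
    { θ.res.X P with I10 := PEmpty, runs10 := (fun i => nomatch i), c12 := ⟨0, 0, 0, 0, 0, 0, 0, 0, 0, 0⟩, S13 := junk P }
  refine ⟨X', fun _ => Y₁, fun _ => Z₁, fun w P hup => ?_⟩
  have key := B13NodeKnitRecord5C.inEdges_iff_res₅C F N
    ({ θ with res := { θ.res with X := X', Y := fun _ => Y₁, Z := fun _ => Z₁ } } : Stage5Params F N) w P hup
  have h13 := B13NodeKnitRecord5C.b13_leaf_iff_res₅C F N
    ({ θ with res := { θ.res with X := X', Y := fun _ => Y₁, Z := fun _ => Z₁ } } : Stage5Params F N) w P hup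
  exact ⟨key.1.2 hY₁, key.2.1.2 ⟨fun _ _ _ _ => ⟨0, (fun i => nomatch i)⟩, (fun i => nomatch i)⟩, key.2.2.1.2 hZ₁,
    key.2.2.2.2 fun hR => absurd hR.1 (lt_irrefl _), fun hb => hjunk P (h13.1 hb).1⟩

/-- **THE GENERIC REGRESSION TEST**: if a record predicate `Rec` is INHABITED on some family and CLOSED UNDER CARRIER SWAPS — every record's world is bound to the
C-binding over some Stage-5 parameters `θ`, and re-binding it over `θ` with ANY residual families `X', Y', Z'` is again a record (at some datum) — then
`S_N10 Rec` is FALSE.  ₅C (`B11LeafUnpinnedRecord.isRecordOfRecord₅C_updXYZ`), ₈C (`…₈C_updXYZ` with `toStage5_updXYZ₈`), ₉C (`B13ResidualSlotProbe9.isRecordOfRecord₉C_updXYZ`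
with `toStage5_updXYZ₉`) are swap-closed; a successor record passes this test exactly by pinning `(res.X P).S13 ∕ c13` (and its sisters' slots) to objects.
[cite: Balaban1988RG2Cluster, Lemmas 1–3 pp.9, 11, 20 (bookkeeping: the stub over any carrier-swap-closed record predicate is refutable)] -/
theorem not_s_N10_of_swapClosed (Rec : RecordPred N)
    (hinh : ∃ (F : T4Family) (D : FiniteEpsData F (Node00.SU N)) (w : WorldP), Rec F D w)
    (hswap : ∀ (F : T4Family) (D : FiniteEpsData F (Node00.SU N)) (w : WorldP), Rec F D w →
      ∃ θ : Stage5Params F N, ∀ (X' : B12.RunParams → PrintedCarriersR) (Y' : B12.RunParams → PrintedCarriers9X)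
        (Z' : B12.RunParams → PrintedCarriers11), ∃ D' : FiniteEpsData F (Node00.SU N),
          Rec F D' { w with up := fun P => upOfRecord₅C F N ({ θ with res := { θ.res with X := X', Y := Y', Z := Z' } } : Stage5Params F N) P }) :
    ¬ S_N10 Rec := by
  intro h
  obtain ⟨F, D, w, hR⟩ := hinh
  obtain ⟨θ, hsw⟩ := hswap F D w hR
  obtain ⟨X', Y', Z', hw⟩ := exists_swap_inEdges_not_b13 N θ
  obtain ⟨D', hR'⟩ := hsw X' Y' Z'
  have hl := hw { w with up := fun P => upOfRecord₅C F N ({ θ with res := { θ.res with X := X', Y := Y', Z := Z' } } : Stage5Params F N) P }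
    ⟨0, 0, 0⟩ rfl
  exact hl.2.2.2.2 (h F D' _ hR' ⟨0, 0, 0⟩ hl.1 hl.2.1 hl.2.2.1 hl.2.2.2.1)

/-- The ₅C instance of the generic test (a second proof of `not_s_N10_record₅C`, through swap-closure `B11LeafUnpinnedRecord.isRecordOfRecord₅C_updXYZ` and
inhabitation `Node00.N24_exists_isRecordOfRecord₅C` on the family `L = 13, m = 1`). [cite: Balaban1988RG2Cluster, Lemmas 1–3 pp.9, 11, 20 (bookkeeping)] -/
theorem not_s_N10_record₅C' : ¬ S_N10 (fun F D w => IsRecordOfRecord₅C F N D w) := by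
  let F13 : T4Family := ⟨13, ⟨⟨6, rfl⟩, by norm_num⟩, by norm_num, 1, le_rfl⟩
  refine not_s_N10_of_swapClosed N _ ⟨F13, Node00.N24_exists_isRecordOfRecord₅C F13 N⟩ fun F D w hR => ?_
  obtain ⟨θ, -, -, hrec⟩ := B11LeafUnpinnedRecord.isRecordOfRecord₅C_updXYZ hR
  exact ⟨θ, fun X' Y' Z' => ⟨D, hrec X' Y' Z'⟩⟩

/-- The ₉C instance of the generic test (a second proof of `not_s_N10_record₉C`): swap-closure by `B13ResidualSlotProbe9.isRecordOfRecord₉C_updXYZ` +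
`toStage5_updXYZ₉`. [cite: Balaban1988RG2Cluster, Lemmas 1–3 pp.9, 11, 20 (bookkeeping)] -/
theorem not_s_N10_record₉C' (hex : ∃ (F : T4Family) (D : FiniteEpsData F (Node00.SU N)) (w : WorldP), IsRecordOfRecord₉C F N D w) :
    ¬ S_N10 (fun F D w => IsRecordOfRecord₉C F N D w) := by
  refine not_s_N10_of_swapClosed N _ hex fun F D w hR => ?_
  obtain ⟨θ, -, hrec⟩ := B13ResidualSlotProbe9.isRecordOfRecord₉C_updXYZ hR
  refine ⟨θ.toStage5 F N, fun X' Y' Z' => ⟨D, ?_⟩⟩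
  rw [← B13ResidualSlotProbe9.toStage5_updXYZ₉]
  exact hrec X' Y' Z'

/-! ## §5 (v2) The located caveat as a theorem: a torus-pin HYPOTHESIS quantified over all admissible parameters of an unpinned stage is unsatisfiable -/

/-- The torus catalogue `𝐃_j` is inhabited: the single cube `{0}` is a localization domain (plumbing). [folklore] -/
private theorem tdom_nonempty (d n : ℕ) [NeZero n] : Nonempty (TreeLengthTorus.TDom d n) :=
  ⟨⟨{(0 : TreeLengthTorus.TPt d n)}, Finset.singleton_nonempty _, fun x hx y hy => by
    rw [Finset.mem_singleton] at hx hy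
    subst hx; subst hy
    exact Relation.ReflTransGen.refl⟩⟩

/-- **A TORUS-PIN HYPOTHESIS OVER ALL ADMISSIBLE STAGE-5 PARAMETERS IS UNSATISFIABLE**: as soon as one admissible `θ₀` exists, no family of two-scale torus step
data `Wt θ P` satisfies «`(θ.res.X P).S13 = (Wt θ P).toStepData` for every admissible `θ` and run `P`» — the residual B13 step is free, and a step datum with NO
localization domains (admissible as a residual) is the record of no torus step (whose `𝐃_k` is the inhabited torus catalogue).  Hence the hypothesis `hS` of
`B13NodeKnitRecord5C.b13_main_forall_isRecordOfRecord₅C_twoTorus` (per family) is as unsatisfiable as the slot (B13₅): the pin must be a CLAUSE OF THE RECORD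
PREDICATE (the carrier-pinning successor), not a hypothesis over its free parameters. [cite: Balaban1988RG2Cluster, Lemmas 1–3 pp.9, 11, 20 (bookkeeping: satisfiability of a pin hypothesis over NODE 00's unpinned Stage-5 parameters)] -/
theorem not_torusPin₅C {F : T4Family} (θ₀ : Stage5Params F N) (h₀ : θ₀.Admissible)
    (L N' : Stage5Params F N → B12.RunParams → ℕ) [∀ θ P, NeZero (L θ P)] [∀ θ P, NeZero (N' θ P)]
    (Wt : (θ : Stage5Params F N) → (P : B12.RunParams) → B13Lemma3Torus.TwoTorusStep 4 (L θ P) (N' θ P)) :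
    ¬ ∀ θ : Stage5Params F N, θ.Admissible → ∀ P : B12.RunParams, (θ.res.X P).S13 = (Wt θ P).toStepData := by
  intro hpin
  -- a residual B13 step with NO localization domains
  let S₀ : B13.StepData :=
    { Dk := { Dom := PEmpty, dj := (fun x => nomatch x), dj_nonneg := (fun x => nomatch x) },
      Dk1 := { Dom := PEmpty, dj := (fun x => nomatch x), dj_nonneg := (fun x => nomatch x) },
      volk := (fun x => nomatch x), Φ := PUnit, Bond := PEmpty, sp1 := (fun x => nomatch x), sp2 := (fun x => nomatch x),
      Bv := (fun _ b => nomatch b), Vp := (fun x => nomatch x), V := (fun x => nomatch x), Q := (fun x => nomatch x),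
      Vpp := (fun x => nomatch x), H := (fun x => nomatch x), Ek1 := (fun x => nomatch x), Elog := (fun x => nomatch x),
      Analytic := fun _ _ => True, GaugeInv := fun _ => True, Repr17 := True, Restr := True }
  let θ₁ : Stage5Params F N := { θ₀ with res := { θ₀.res with X := fun P => { θ₀.res.X P with S13 := S₀ } } }
  have h₁ : θ₁.Admissible := h₀
  have h := hpin θ₁ h₁ ⟨0, 0, 0⟩
  have hD : S₀.Dk.Dom = ((Wt θ₁ ⟨0, 0, 0⟩).toStepData).Dk.Dom := congrArg (fun S : B13.StepData => S.Dk.Dom) h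
  have hne : Nonempty ((Wt θ₁ ⟨0, 0, 0⟩).toStepData).Dk.Dom := tdom_nonempty 4 _
  rw [← hD] at hne
  obtain ⟨x⟩ := hne
  exact nomatch x

/-- **Hence the hypothesis `hS` of `N10AtRecord.s_N10_of_refines₅C_twoTorus` is UNSATISFIABLE** («for every family, every admissible Stage-5 parameter and every
run, `(θ.res.X P).S13 = (Wt F θ P).toStepData`»; admissible parameters exist on the family `L = 13, m = 1` by `Node00.N24_exists_isRecordOfRecord₅C`): that landed
closer, like `s_N10_rec₅C ∕ ₇C ∕ ₈C`, is correct AND certified vacuous — the `Rec`-generic closer of record is `N10AtRecord.s_N10_of_leaf_b13` fed per record and run by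
`B13NodeKnitRecord5C.b13_main_at_stage5ParamsC_twoTorus` at a PINNED record. [cite: Balaban1988RG2Cluster, Lemmas 1–3 pp.9, 11, 20 (bookkeeping: satisfiability of the torus-pin hypothesis)] -/
theorem not_torusPinHyp₅C
    (L N' : (F : T4Family) → Stage5Params F N → B12.RunParams → ℕ) [∀ F θ P, NeZero (L F θ P)] [∀ F θ P, NeZero (N' F θ P)]
    (Wt : (F : T4Family) → (θ : Stage5Params F N) → (P : B12.RunParams) → B13Lemma3Torus.TwoTorusStep 4 (L F θ P) (N' F θ P)) :
    ¬ ∀ (F : T4Family) (θ : Stage5Params F N), θ.Admissible → ∀ P : B12.RunParams, (θ.res.X P).S13 = (Wt F θ P).toStepData := by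
  intro h
  let F13 : T4Family := ⟨13, ⟨⟨6, rfl⟩, by norm_num⟩, by norm_num, 1, le_rfl⟩
  obtain ⟨D, w, θ₀, h₀, -⟩ := Node00.N24_exists_isRecordOfRecord₅C F13 N
  exact not_torusPin₅C N θ₀ h₀ (L F13) (N' F13) (Wt F13) (h F13)

/-! ## §6 (v2) The regression test OF THE B13 PIN ITSELF: `S13`-only swap closure + one record with the in-edges true refutes the stub -/

/-- **THE TEST A CUMULATIVE CARRIER-PINNING STAGE MUST FAIL EXACTLY WHEN IT PINS `S13`**: if a record predicate `Rec` (i) has ONE record and run at which the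
four in-edge leaves `b9 b10 b11 b12` hold (supplied, stage by stage, by the sisters' pins ∕ closers — e.g. a pinned [B9] layer, N08's closer at the pinned
[B10] runs — or by junk where those groups are still free), and (ii) is closed under replacing ONLY the residual B13 step `(res.X P).S13` of the Stage-5 parameters
its worlds are bound over (every other carrier, pinned or not, untouched), then `S_N10 Rec` is FALSE: the in-edges survive the `S13`-swap (`Iff.rfl`-located at
unchanged carriers, `B13NodeKnitRecord5C.inEdges_iff_res₅C`) and g5's junk step kills `b13`.  NODE 00's cumulative pins (`₉CB10`, `₉CB10Y`, …) keep (ii) until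
the B13 group itself is pinned. [cite: Balaban1988RG2Cluster, Lemmas 1–3 pp.9, 11, 20; p.1 (in-edges) (bookkeeping: the stub over any `S13`-swap-closed record predicate is refutable)] -/
theorem not_s_N10_of_s13SwapClosed (Rec : RecordPred N)
    (hinh : ∃ (F : T4Family) (D : FiniteEpsData F (Node00.SU N)) (w : WorldP), Rec F D w ∧ ∃ P : B12.RunParams,
      (leavesP w P).b9 ∧ (leavesP w P).b10 ∧ (leavesP w P).b11 ∧ (leavesP w P).b12)
    (hswap : ∀ (F : T4Family) (D : FiniteEpsData F (Node00.SU N)) (w : WorldP), Rec F D w →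
      ∃ θ : Stage5Params F N, (∀ P, w.up P = upOfRecord₅C F N θ P) ∧
        ∀ S' : B12.RunParams → B13.StepData, ∃ D' : FiniteEpsData F (Node00.SU N),
          Rec F D'
            { w with
              up := fun P => upOfRecord₅C F N ({ θ with res := { θ.res with X := fun P => { θ.res.X P with S13 := S' P } } } : Stage5Params F N) P }) :
    ¬ S_N10 Rec := by
  intro h
  obtain ⟨F, D, w, hR, P₀, h9, h10, h11, h12⟩ := hinh
  obtain ⟨θ, hup, hsw⟩ := hswap F D w hR
  let junk : B12.RunParams → B13.StepData := fun P =>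
    Classical.choose (B13ResidualLeafProbe.exists_stepData_not_lemma1 ((θ.res.X P).c13))
  have hjunk : ∀ P, ¬ B13.Lemma1Printed (junk P) ((θ.res.X P).c13) := fun P =>
    Classical.choose_spec (B13ResidualLeafProbe.exists_stepData_not_lemma1 ((θ.res.X P).c13))
  obtain ⟨D', hR'⟩ := hsw junk
  let θ' : Stage5Params F N := { θ with res := { θ.res with X := fun P => { θ.res.X P with S13 := junk P } } }
  have old := B13NodeKnitRecord5C.inEdges_iff_res₅C F N θ w P₀ (hup P₀)
  have new := B13NodeKnitRecord5C.inEdges_iff_res₅C F N θ' { w with up := fun P => upOfRecord₅C F N θ' P } P₀ rfl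
  have h13 := B13NodeKnitRecord5C.b13_leaf_iff_res₅C F N θ' { w with up := fun P => upOfRecord₅C F N θ' P } P₀ rfl
  have hb := h F D' _ hR' P₀ (new.1.2 (old.1.1 h9)) (new.2.1.2 (old.2.1.1 h10)) (new.2.2.1.2 (old.2.2.1.1 h11))
    (new.2.2.2.2 (old.2.2.2.1 h12))
  exact hjunk P₀ (h13.1 hb).1

/-- The ₅C instance of the `S13`-test (a third proof of `not_s_N10_record₅C`): the in-edge-true record of `B13ResidualSlotProbe.exists_record₅C_inEdges_not_b13` on the
family `L = 13, m = 1`, and `S13`-swap closure as the special case `X' := (S13 ↦ S')`, `Y' := res.Y`, `Z' := res.Z` of `B11LeafUnpinnedRecord.isRecordOfRecord₅C_updXYZ`.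
[cite: Balaban1988RG2Cluster, Lemmas 1–3 pp.9, 11, 20 (bookkeeping)] -/
theorem not_s_N10_record₅C'' : ¬ S_N10 (fun F D w => IsRecordOfRecord₅C F N D w) := by
  let F13 : T4Family := ⟨13, ⟨⟨6, rfl⟩, by norm_num⟩, by norm_num, 1, le_rfl⟩
  obtain ⟨D₀, w₀, h₀⟩ := Node00.N24_exists_isRecordOfRecord₅C F13 N
  obtain ⟨w, hw, hl⟩ := B13ResidualSlotProbe.exists_record₅C_inEdges_not_b13 h₀
  refine not_s_N10_of_s13SwapClosed N (fun F D w => IsRecordOfRecord₅C F N D w)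
    ⟨F13, D₀, w, hw, ⟨0, 0, 0⟩, (hl _).1, (hl _).2.1, (hl _).2.2.1, (hl _).2.2.2.1⟩ fun F D w hR => ?_
  obtain ⟨θ, -, hup, hrec⟩ := B11LeafUnpinnedRecord.isRecordOfRecord₅C_updXYZ hR
  exact ⟨θ, hup, fun S' => ⟨D, hrec (fun P => { θ.res.X P with S13 := S' P }) θ.res.Y θ.res.Z⟩⟩

end Summit.QuantumFields.YangMills.Theorems.BalabanUVNodesN10RecordCensus

end
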